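import Summits.BirchSwinnertonDyer.BirchSwinnertonDyer.Theorems.ManinLocalTwoThreeEtaBasisFortyFourC
import Summits.BirchSwinnertonDyer.BirchSwinnertonDyer.Theorems.ManinLocalTwoThreeOldFormsFortyFour
import Summits.BirchSwinnertonDyer.BirchSwinnertonDyer.Theorems.ManinLocalTwoThreeNewformPinningFortyFourOfTable
import Literature.NumberTheory.EllipticCurves.ModularFormsGamma0WeightTwoDimension
import HarnessLib

/-!
# Level 44 (C2 domain, genus 4), part 4a: the nine-form BASIS of `M₂(Γ₀(44))` and its coefficient columns

Cell `bsd-f2-manin`, route `ManinLocalTwoThree`, crux C2 `ManinOddAtFour` (stmt-BirchSwinnertonDyer-22967), LEAD p1 gen 24;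
`--supports stmt-BirchSwinnertonDyer-22967` (helper).  Inputs: `dim M₂(Γ₀(N)) = g + ν_∞ − 1`
(`Literature…ModularFormsGamma0WeightTwoDimension`), the old forms `O_d = ι_d φ₁₁` (`…OldFormsFortyFour`) and the six
holomorphic `η`-quotients `B1, …, B6` (`…EtaBasisFortyFourA/B/C`) with their certified `q`-coefficients through `q³³`.

* §1 `finrank_modularForm_two_fortyFour : dim M₂(Γ₀(44)) = 9`;
* §2 the coefficient functional on combinations (`coeff_sum_smul`) and the COLUMNS of the nine-form family at
  `n ∈ {0,…,8,11} ∪ {9,10,12,15,16,19,33}` (`coeff_comb_n`);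
* §3 the `9 × 9` pivot solve (determinant `10`), linear independence, `basisForms` spans: `exists_coords_fortyFour`.

Part 4b (`…NewformPinningFortyFour`) turns this into the column relations / pivot separation / old witnesses of part 2 and
concludes `⇑D.f = ⇑Φ₄₄`.  Nothing here proves C2, Manin's conjecture or BSD.
[cite: DiamondShurman2005, Thm. 3.5.1, §5.7] [cite: CremonaAlgorithms1997, Table 3 (N = 11, 44)]
-/

set_option autoImplicit false
-- lint-debt: the directory name repeats the summit name (sibling precedent `ManinLocalTwoThreeNewformFortyEight.lean`)
set_option linter.dupNamespace false

noncomputable section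

open Complex Polynomial
open UpperHalfPlane hiding I
open scoped MatrixGroups ModularForm
open CongruenceSubgroup
open Literature.NumberTheory.ModularForms
open Literature.NumberTheory.EllipticCurves Literature.NumberTheory.EllipticCurves.ModularForms

namespace Summit.BirchSwinnertonDyer.BirchSwinnertonDyer.Theorems.ManinLocalTwoThree.LevelFortyFour

/-! ## §1 `dim M₂(Γ₀(44)) = 9` -/

/-- `μ(Γ₀(44)) = 72`, `ν_∞ = 6`, `ν₂ = ν₃ = 0`. [cite: DiamondShurman2005, §3.8] -/
theorem gamma0_data_44 : gamma0Index 44 = 72 ∧ nuInfty 44 = 6 ∧ nu₂ 44 = 0 ∧ nu₃ 44 = 0 :=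
  ⟨(gamma0Index_mul (m := 4) (n := 11) (by norm_num)).trans
      (by rw [show (4 : ℕ) = 2 ^ 2 by norm_num, gamma0Index_prime_pow (p := 2) (e := 2) Nat.prime_two (by norm_num),
        gamma0Index_prime (by norm_num : Nat.Prime 11)]; norm_num),
    by decide, by rw [nu₂_eq_card]; decide, by rw [nu₃_eq_card]; decide⟩

/-- `g(X₀(44)) = 4`. [cite: DiamondShurman2005, Thm. 3.1.1] -/
theorem genusX0_fortyFour : genusX0 44 = 4 := by
  obtain ⟨h1, h2, h3, h4⟩ := gamma0_data_44
  rw [genusX0, h1, h2, h3, h4]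

/-- **`dim M₂(Γ₀(44)) = 9`** (`= g + ν_∞ − 1`). [cite: DiamondShurman2005, Thm. 3.5.1] -/
theorem finrank_modularForm_two_fortyFour : Module.finrank ℂ (ModularForm (Gamma0 44) 2) = 9 := by
  rw [finrank_modularForm_two_eq 44, genusX0_fortyFour, gamma0_data_44.2.1]

/-! ## §2 The nine forms, the coefficient functional, the columns -/

/-- The old forms `O_d = ι_d φ₁₁` viewed in `M₂(Γ₀(44))`. [cite: AtkinLehner1970, §2] -/
def O (d : ℕ) [NeZero d] : ModularForm (Gamma0 44) 2 :=
  CuspForm.toModularFormₗ (degeneracyMap0 11 44 d 2 cuspFormEtaProductEleven)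

/-- The `q`-coefficients of `O_d` are the `cuspCoeff`s of `ι_d φ₁₁`. [folklore] -/
theorem coeff_O (d : ℕ) [NeZero d] (n : ℕ) :
    (qExpansion 1 ⇑(O d)).coeff n = cuspCoeff (degeneracyMap0 11 44 d 2 cuspFormEtaProductEleven) n := by
  rw [O, show (⇑(CuspForm.toModularFormₗ (degeneracyMap0 11 44 d 2 cuspFormEtaProductEleven)) : ℍ → ℂ) =
    ⇑(degeneracyMap0 11 44 d 2 cuspFormEtaProductEleven) from funext (CuspForm.toModularFormₗ_apply _)]
  rfl

/-- The nine forms `(O₁, O₂, O₄, B1, …, B6)`. [folklore] -/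
def basisForms : Fin 9 → ModularForm (Gamma0 44) 2 := ![O 1, O 2, O 4, B1, B2, B3, B4, B5, B6]

/-- `q`-coefficients of a finite combination in `M₂(Γ₀(44))`. [folklore] -/
theorem coeff_sum_smul (c : Fin 9 → ℂ) (v : Fin 9 → ModularForm (Gamma0 44) 2) (n : ℕ) :
    (qExpansion 1 ⇑(∑ i, c i • v i)).coeff n = ∑ i, c i * (qExpansion 1 ⇑(v i)).coeff n := by
  have h1 : qExpansion 1 ⇑(∑ i, c i • v i) = ∑ i, c i • qExpansion 1 ⇑(v i) := by
    change ModularForm.qExpansionAddHom one_pos one_mem_strictPeriods_Gamma0 2 (∑ i, c i • v i) = _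
    rw [map_sum]
    refine Finset.sum_congr rfl fun i _ ↦ ?_
    change qExpansion 1 ⇑(c i • v i) = _
    exact ModularForm.qExpansion_smul one_pos one_mem_strictPeriods_Gamma0 (c i) (v i)
  rw [h1, map_sum]
  simp only [map_smul, smul_eq_mul]


/-- `succ^1 0 = 1` in `Fin 9` (normalisation after `Fin.sum_univ_succ`). [folklore] -/
theorem finSucc1 : ((0 : Fin 8).succ : Fin 9) = 1 := by decide

/-- `succ^2 0 = 2` in `Fin 9` (normalisation after `Fin.sum_univ_succ`). [folklore] -/
theorem finSucc2 : ((0 : Fin 7).succ.succ : Fin 9) = 2 := by decide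

/-- `succ^3 0 = 3` in `Fin 9` (normalisation after `Fin.sum_univ_succ`). [folklore] -/
theorem finSucc3 : ((0 : Fin 6).succ.succ.succ : Fin 9) = 3 := by decide

/-- `succ^4 0 = 4` in `Fin 9` (normalisation after `Fin.sum_univ_succ`). [folklore] -/
theorem finSucc4 : ((0 : Fin 5).succ.succ.succ.succ : Fin 9) = 4 := by decide

/-- `succ^5 0 = 5` in `Fin 9` (normalisation after `Fin.sum_univ_succ`). [folklore] -/
theorem finSucc5 : ((0 : Fin 4).succ.succ.succ.succ.succ : Fin 9) = 5 := by decide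

/-- `succ^6 0 = 6` in `Fin 9` (normalisation after `Fin.sum_univ_succ`). [folklore] -/
theorem finSucc6 : ((0 : Fin 3).succ.succ.succ.succ.succ.succ : Fin 9) = 6 := by decide

/-- `succ^7 0 = 7` in `Fin 9` (normalisation after `Fin.sum_univ_succ`). [folklore] -/
theorem finSucc7 : ((0 : Fin 2).succ.succ.succ.succ.succ.succ.succ : Fin 9) = 7 := by decide

/-- `succ^8 0 = 8` in `Fin 9` (normalisation after `Fin.sum_univ_succ`). [folklore] -/
theorem finSucc8 : ((0 : Fin 1).succ.succ.succ.succ.succ.succ.succ.succ : Fin 9) = 8 := by decide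


/-- The seventeen needed `q`-coefficients of `O1`. [cite: CremonaAlgorithms1997, Table 3 (N = 11)] -/
theorem cols_O1 :
    (qExpansion 1 ⇑(O 1)).coeff 0 = (0 : ℂ) ∧
    (qExpansion 1 ⇑(O 1)).coeff 1 = (1 : ℂ) ∧
    (qExpansion 1 ⇑(O 1)).coeff 2 = (-2 : ℂ) ∧
    (qExpansion 1 ⇑(O 1)).coeff 3 = (-1 : ℂ) ∧
    (qExpansion 1 ⇑(O 1)).coeff 4 = (2 : ℂ) ∧
    (qExpansion 1 ⇑(O 1)).coeff 5 = (1 : ℂ) ∧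
    (qExpansion 1 ⇑(O 1)).coeff 6 = (2 : ℂ) ∧
    (qExpansion 1 ⇑(O 1)).coeff 7 = (-2 : ℂ) ∧
    (qExpansion 1 ⇑(O 1)).coeff 8 = (0 : ℂ) ∧
    (qExpansion 1 ⇑(O 1)).coeff 9 = (-2 : ℂ) ∧
    (qExpansion 1 ⇑(O 1)).coeff 10 = (-2 : ℂ) ∧
    (qExpansion 1 ⇑(O 1)).coeff 11 = (1 : ℂ) ∧
    (qExpansion 1 ⇑(O 1)).coeff 12 = (-2 : ℂ) ∧
    (qExpansion 1 ⇑(O 1)).coeff 15 = (-1 : ℂ) ∧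
    (qExpansion 1 ⇑(O 1)).coeff 16 = (-4 : ℂ) ∧
    (qExpansion 1 ⇑(O 1)).coeff 19 = (0 : ℂ) ∧
    (qExpansion 1 ⇑(O 1)).coeff 33 = (-1 : ℂ) := by
  refine ⟨?_, ?_, ?_, ?_, ?_, ?_, ?_, ?_, ?_, ?_, ?_, ?_, ?_, ?_, ?_, ?_, ?_⟩ <;> (rw [coeff_O, cuspCoeff_iota1_phi11 _ (by norm_num)]; norm_num)


/-- The seventeen needed `q`-coefficients of `O2`. [cite: CremonaAlgorithms1997, Table 3 (N = 11)] -/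
theorem cols_O2 :
    (qExpansion 1 ⇑(O 2)).coeff 0 = (0 : ℂ) ∧
    (qExpansion 1 ⇑(O 2)).coeff 1 = (0 : ℂ) ∧
    (qExpansion 1 ⇑(O 2)).coeff 2 = (2 : ℂ) ∧
    (qExpansion 1 ⇑(O 2)).coeff 3 = (0 : ℂ) ∧
    (qExpansion 1 ⇑(O 2)).coeff 4 = (-4 : ℂ) ∧
    (qExpansion 1 ⇑(O 2)).coeff 5 = (0 : ℂ) ∧
    (qExpansion 1 ⇑(O 2)).coeff 6 = (-2 : ℂ) ∧
    (qExpansion 1 ⇑(O 2)).coeff 7 = (0 : ℂ) ∧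
    (qExpansion 1 ⇑(O 2)).coeff 8 = (4 : ℂ) ∧
    (qExpansion 1 ⇑(O 2)).coeff 9 = (0 : ℂ) ∧
    (qExpansion 1 ⇑(O 2)).coeff 10 = (2 : ℂ) ∧
    (qExpansion 1 ⇑(O 2)).coeff 11 = (0 : ℂ) ∧
    (qExpansion 1 ⇑(O 2)).coeff 12 = (4 : ℂ) ∧
    (qExpansion 1 ⇑(O 2)).coeff 15 = (0 : ℂ) ∧
    (qExpansion 1 ⇑(O 2)).coeff 16 = (0 : ℂ) ∧
    (qExpansion 1 ⇑(O 2)).coeff 19 = (0 : ℂ) ∧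
    (qExpansion 1 ⇑(O 2)).coeff 33 = (0 : ℂ) := by
  refine ⟨?_, ?_, ?_, ?_, ?_, ?_, ?_, ?_, ?_, ?_, ?_, ?_, ?_, ?_, ?_, ?_, ?_⟩ <;> (rw [coeff_O, cuspCoeff_iota2_phi11 _ (by norm_num)]; norm_num)


/-- The seventeen needed `q`-coefficients of `O4`. [cite: CremonaAlgorithms1997, Table 3 (N = 11)] -/
theorem cols_O4 :
    (qExpansion 1 ⇑(O 4)).coeff 0 = (0 : ℂ) ∧
    (qExpansion 1 ⇑(O 4)).coeff 1 = (0 : ℂ) ∧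
    (qExpansion 1 ⇑(O 4)).coeff 2 = (0 : ℂ) ∧
    (qExpansion 1 ⇑(O 4)).coeff 3 = (0 : ℂ) ∧
    (qExpansion 1 ⇑(O 4)).coeff 4 = (4 : ℂ) ∧
    (qExpansion 1 ⇑(O 4)).coeff 5 = (0 : ℂ) ∧
    (qExpansion 1 ⇑(O 4)).coeff 6 = (0 : ℂ) ∧
    (qExpansion 1 ⇑(O 4)).coeff 7 = (0 : ℂ) ∧
    (qExpansion 1 ⇑(O 4)).coeff 8 = (-8 : ℂ) ∧
    (qExpansion 1 ⇑(O 4)).coeff 9 = (0 : ℂ) ∧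
    (qExpansion 1 ⇑(O 4)).coeff 10 = (0 : ℂ) ∧
    (qExpansion 1 ⇑(O 4)).coeff 11 = (0 : ℂ) ∧
    (qExpansion 1 ⇑(O 4)).coeff 12 = (-4 : ℂ) ∧
    (qExpansion 1 ⇑(O 4)).coeff 15 = (0 : ℂ) ∧
    (qExpansion 1 ⇑(O 4)).coeff 16 = (8 : ℂ) ∧
    (qExpansion 1 ⇑(O 4)).coeff 19 = (0 : ℂ) ∧
    (qExpansion 1 ⇑(O 4)).coeff 33 = (0 : ℂ) := by
  refine ⟨?_, ?_, ?_, ?_, ?_, ?_, ?_, ?_, ?_, ?_, ?_, ?_, ?_, ?_, ?_, ?_, ?_⟩ <;> (rw [coeff_O, cuspCoeff_iota4_phi11 _ (by norm_num)]; norm_num)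


/-- The seventeen needed `q`-coefficients of `B1`. [cite: CremonaAlgorithms1997, Table 3 (N = 11)] -/
theorem cols_B1 :
    (qExpansion 1 ⇑(B1)).coeff 0 = (0 : ℂ) ∧
    (qExpansion 1 ⇑(B1)).coeff 1 = (0 : ℂ) ∧
    (qExpansion 1 ⇑(B1)).coeff 2 = (0 : ℂ) ∧
    (qExpansion 1 ⇑(B1)).coeff 3 = (0 : ℂ) ∧
    (qExpansion 1 ⇑(B1)).coeff 4 = (0 : ℂ) ∧
    (qExpansion 1 ⇑(B1)).coeff 5 = (0 : ℂ) ∧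
    (qExpansion 1 ⇑(B1)).coeff 6 = (0 : ℂ) ∧
    (qExpansion 1 ⇑(B1)).coeff 7 = (0 : ℂ) ∧
    (qExpansion 1 ⇑(B1)).coeff 8 = (0 : ℂ) ∧
    (qExpansion 1 ⇑(B1)).coeff 9 = (0 : ℂ) ∧
    (qExpansion 1 ⇑(B1)).coeff 10 = (0 : ℂ) ∧
    (qExpansion 1 ⇑(B1)).coeff 11 = (1 : ℂ) ∧
    (qExpansion 1 ⇑(B1)).coeff 12 = (0 : ℂ) ∧
    (qExpansion 1 ⇑(B1)).coeff 15 = (0 : ℂ) ∧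
    (qExpansion 1 ⇑(B1)).coeff 16 = (0 : ℂ) ∧
    (qExpansion 1 ⇑(B1)).coeff 19 = (0 : ℂ) ∧
    (qExpansion 1 ⇑(B1)).coeff 33 = (4 : ℂ) := by
  refine ⟨?_, ?_, ?_, ?_, ?_, ?_, ?_, ?_, ?_, ?_, ?_, ?_, ?_, ?_, ?_, ?_, ?_⟩ <;> (rw [coeff_B1 _ (by norm_num)]; norm_num)


/-- The seventeen needed `q`-coefficients of `B2`. [cite: CremonaAlgorithms1997, Table 3 (N = 11)] -/
theorem cols_B2 :
    (qExpansion 1 ⇑(B2)).coeff 0 = (0 : ℂ) ∧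
    (qExpansion 1 ⇑(B2)).coeff 1 = (1 : ℂ) ∧
    (qExpansion 1 ⇑(B2)).coeff 2 = (0 : ℂ) ∧
    (qExpansion 1 ⇑(B2)).coeff 3 = (1 : ℂ) ∧
    (qExpansion 1 ⇑(B2)).coeff 4 = (0 : ℂ) ∧
    (qExpansion 1 ⇑(B2)).coeff 5 = (1 : ℂ) ∧
    (qExpansion 1 ⇑(B2)).coeff 6 = (0 : ℂ) ∧
    (qExpansion 1 ⇑(B2)).coeff 7 = (2 : ℂ) ∧
    (qExpansion 1 ⇑(B2)).coeff 8 = (0 : ℂ) ∧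
    (qExpansion 1 ⇑(B2)).coeff 9 = (2 : ℂ) ∧
    (qExpansion 1 ⇑(B2)).coeff 10 = (0 : ℂ) ∧
    (qExpansion 1 ⇑(B2)).coeff 11 = (3 : ℂ) ∧
    (qExpansion 1 ⇑(B2)).coeff 12 = (0 : ℂ) ∧
    (qExpansion 1 ⇑(B2)).coeff 15 = (5 : ℂ) ∧
    (qExpansion 1 ⇑(B2)).coeff 16 = (0 : ℂ) ∧
    (qExpansion 1 ⇑(B2)).coeff 19 = (8 : ℂ) ∧
    (qExpansion 1 ⇑(B2)).coeff 33 = (11 : ℂ) := by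
  refine ⟨?_, ?_, ?_, ?_, ?_, ?_, ?_, ?_, ?_, ?_, ?_, ?_, ?_, ?_, ?_, ?_, ?_⟩ <;> (rw [coeff_B2 _ (by norm_num)]; norm_num)


/-- The seventeen needed `q`-coefficients of `B3`. [cite: CremonaAlgorithms1997, Table 3 (N = 11)] -/
theorem cols_B3 :
    (qExpansion 1 ⇑(B3)).coeff 0 = (0 : ℂ) ∧
    (qExpansion 1 ⇑(B3)).coeff 1 = (0 : ℂ) ∧
    (qExpansion 1 ⇑(B3)).coeff 2 = (0 : ℂ) ∧
    (qExpansion 1 ⇑(B3)).coeff 3 = (0 : ℂ) ∧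
    (qExpansion 1 ⇑(B3)).coeff 4 = (0 : ℂ) ∧
    (qExpansion 1 ⇑(B3)).coeff 5 = (0 : ℂ) ∧
    (qExpansion 1 ⇑(B3)).coeff 6 = (1 : ℂ) ∧
    (qExpansion 1 ⇑(B3)).coeff 7 = (0 : ℂ) ∧
    (qExpansion 1 ⇑(B3)).coeff 8 = (2 : ℂ) ∧
    (qExpansion 1 ⇑(B3)).coeff 9 = (0 : ℂ) ∧
    (qExpansion 1 ⇑(B3)).coeff 10 = (1 : ℂ) ∧
    (qExpansion 1 ⇑(B3)).coeff 11 = (0 : ℂ) ∧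
    (qExpansion 1 ⇑(B3)).coeff 12 = (2 : ℂ) ∧
    (qExpansion 1 ⇑(B3)).coeff 15 = (0 : ℂ) ∧
    (qExpansion 1 ⇑(B3)).coeff 16 = (0 : ℂ) ∧
    (qExpansion 1 ⇑(B3)).coeff 19 = (0 : ℂ) ∧
    (qExpansion 1 ⇑(B3)).coeff 33 = (0 : ℂ) := by
  refine ⟨?_, ?_, ?_, ?_, ?_, ?_, ?_, ?_, ?_, ?_, ?_, ?_, ?_, ?_, ?_, ?_, ?_⟩ <;> (rw [coeff_B3 _ (by norm_num)]; norm_num)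


/-- The seventeen needed `q`-coefficients of `B4`. [cite: CremonaAlgorithms1997, Table 3 (N = 11)] -/
theorem cols_B4 :
    (qExpansion 1 ⇑(B4)).coeff 0 = (0 : ℂ) ∧
    (qExpansion 1 ⇑(B4)).coeff 1 = (1 : ℂ) ∧
    (qExpansion 1 ⇑(B4)).coeff 2 = (0 : ℂ) ∧
    (qExpansion 1 ⇑(B4)).coeff 3 = (4 : ℂ) ∧
    (qExpansion 1 ⇑(B4)).coeff 4 = (0 : ℂ) ∧
    (qExpansion 1 ⇑(B4)).coeff 5 = (6 : ℂ) ∧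
    (qExpansion 1 ⇑(B4)).coeff 6 = (0 : ℂ) ∧
    (qExpansion 1 ⇑(B4)).coeff 7 = (8 : ℂ) ∧
    (qExpansion 1 ⇑(B4)).coeff 8 = (0 : ℂ) ∧
    (qExpansion 1 ⇑(B4)).coeff 9 = (13 : ℂ) ∧
    (qExpansion 1 ⇑(B4)).coeff 10 = (0 : ℂ) ∧
    (qExpansion 1 ⇑(B4)).coeff 11 = (12 : ℂ) ∧
    (qExpansion 1 ⇑(B4)).coeff 12 = (0 : ℂ) ∧
    (qExpansion 1 ⇑(B4)).coeff 15 = (24 : ℂ) ∧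
    (qExpansion 1 ⇑(B4)).coeff 16 = (0 : ℂ) ∧
    (qExpansion 1 ⇑(B4)).coeff 19 = (20 : ℂ) ∧
    (qExpansion 1 ⇑(B4)).coeff 33 = (48 : ℂ) := by
  refine ⟨?_, ?_, ?_, ?_, ?_, ?_, ?_, ?_, ?_, ?_, ?_, ?_, ?_, ?_, ?_, ?_, ?_⟩ <;> (rw [coeff_B4 _ (by norm_num)]; norm_num)


/-- The seventeen needed `q`-coefficients of `B5`. [cite: CremonaAlgorithms1997, Table 3 (N = 11)] -/
theorem cols_B5 :
    (qExpansion 1 ⇑(B5)).coeff 0 = (1 : ℂ) ∧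
    (qExpansion 1 ⇑(B5)).coeff 1 = (0 : ℂ) ∧
    (qExpansion 1 ⇑(B5)).coeff 2 = (0 : ℂ) ∧
    (qExpansion 1 ⇑(B5)).coeff 3 = (0 : ℂ) ∧
    (qExpansion 1 ⇑(B5)).coeff 4 = (0 : ℂ) ∧
    (qExpansion 1 ⇑(B5)).coeff 5 = (0 : ℂ) ∧
    (qExpansion 1 ⇑(B5)).coeff 6 = (0 : ℂ) ∧
    (qExpansion 1 ⇑(B5)).coeff 7 = (0 : ℂ) ∧
    (qExpansion 1 ⇑(B5)).coeff 8 = (0 : ℂ) ∧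
    (qExpansion 1 ⇑(B5)).coeff 9 = (0 : ℂ) ∧
    (qExpansion 1 ⇑(B5)).coeff 10 = (0 : ℂ) ∧
    (qExpansion 1 ⇑(B5)).coeff 11 = (8 : ℂ) ∧
    (qExpansion 1 ⇑(B5)).coeff 12 = (0 : ℂ) ∧
    (qExpansion 1 ⇑(B5)).coeff 15 = (0 : ℂ) ∧
    (qExpansion 1 ⇑(B5)).coeff 16 = (0 : ℂ) ∧
    (qExpansion 1 ⇑(B5)).coeff 19 = (0 : ℂ) ∧
    (qExpansion 1 ⇑(B5)).coeff 33 = (32 : ℂ) := by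
  refine ⟨?_, ?_, ?_, ?_, ?_, ?_, ?_, ?_, ?_, ?_, ?_, ?_, ?_, ?_, ?_, ?_, ?_⟩ <;> (rw [coeff_B5 _ (by norm_num)]; norm_num)


/-- The seventeen needed `q`-coefficients of `B6`. [cite: CremonaAlgorithms1997, Table 3 (N = 11)] -/
theorem cols_B6 :
    (qExpansion 1 ⇑(B6)).coeff 0 = (0 : ℂ) ∧
    (qExpansion 1 ⇑(B6)).coeff 1 = (0 : ℂ) ∧
    (qExpansion 1 ⇑(B6)).coeff 2 = (0 : ℂ) ∧
    (qExpansion 1 ⇑(B6)).coeff 3 = (0 : ℂ) ∧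
    (qExpansion 1 ⇑(B6)).coeff 4 = (0 : ℂ) ∧
    (qExpansion 1 ⇑(B6)).coeff 5 = (1 : ℂ) ∧
    (qExpansion 1 ⇑(B6)).coeff 6 = (1 : ℂ) ∧
    (qExpansion 1 ⇑(B6)).coeff 7 = (0 : ℂ) ∧
    (qExpansion 1 ⇑(B6)).coeff 8 = (1 : ℂ) ∧
    (qExpansion 1 ⇑(B6)).coeff 9 = (1 : ℂ) ∧
    (qExpansion 1 ⇑(B6)).coeff 10 = (1 : ℂ) ∧
    (qExpansion 1 ⇑(B6)).coeff 11 = (1 : ℂ) ∧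
    (qExpansion 1 ⇑(B6)).coeff 12 = (1 : ℂ) ∧
    (qExpansion 1 ⇑(B6)).coeff 15 = (2 : ℂ) ∧
    (qExpansion 1 ⇑(B6)).coeff 16 = (-1 : ℂ) ∧
    (qExpansion 1 ⇑(B6)).coeff 19 = (0 : ℂ) ∧
    (qExpansion 1 ⇑(B6)).coeff 33 = (3 : ℂ) := by
  refine ⟨?_, ?_, ?_, ?_, ?_, ?_, ?_, ?_, ?_, ?_, ?_, ?_, ?_, ?_, ?_, ?_, ?_⟩ <;> (rw [coeff_B6 _ (by norm_num)]; norm_num)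

end Summit.BirchSwinnertonDyer.BirchSwinnertonDyer.Theorems.ManinLocalTwoThree.LevelFortyFour

end
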